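import Literature.NumberTheory.Automorphic.AutomorphicFormsL2OrbitalSmoothing
import Literature.AlgebraicGeometry.ShimuraVarieties.UnitaryBallCauchyRiemann
import Literature.Geometry.ComplexHyperbolic.UnitBallU21Borel
import HarnessLib

/-!
# Orbital smoothing along `U(2,1)`-orbits through the exponential `𝔭`-chart `b ↦ exp X_b`

Topic `NumberTheory/Automorphic`; the `U = U(2,1)` layer over `AutomorphicFormsL2OrbitalSmoothing` (generic locally compact
`U`).  Everything is PROVED; no definition, no instance, no `sorry`.  The statements are SCOPE-FREE (no matrix-norm instance is
needed to state them): the regularity of a scalar kernel `α : U(2,1) → ℂ` is expressed, exactly as in the (D)-desk sub-line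
`Cruxes/H413/Lines/F0_P2SpectralProjectionD.lean` (`IsRegularKernel`, applied entrywise), by
`∀ u, ContDiff ℝ 1 (b ↦ α (exp X_b · u))` and joint continuity of `(b, u) ↦ D_b α(exp X_b · u)` (★ `BallForms.expP`).

* §1 the chart: `expP_neg : exp X_{-b} = (exp X_b)⁻¹` (cf. ★ `KonnoKonno2007.expP_neg_mul_expP`), `continuous_expP`.
* §2 probe calculus of such a kernel along the RIGHT-hand probes `b ↦ α((exp X_b)⁻¹ u)` that the orbit formula produces
  (`AdelicGroupData.orbitalIntegral_mul_hom`): differentiability with the honest token `fderiv ℝ (b' ↦ α((exp X_{b'})⁻¹ u)) b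
  = -(D_b α(exp X_b u))|_{-b}` (`hasFDerivAt_comp_expP_inv_mul(')`, `fderiv_comp_expP_inv_mul`), joint continuity in `(b, u)`
  (`continuous_fderiv_comp_expP_inv_mul`), compact support in `u` locally uniformly in `b`
  (`fderiv_comp_expP_inv_mul_eq_zero`, `hasCompactSupport_fderiv_comp_expP_inv_mul`), and the evaluated derivative kernels
  `u ↦ D(b₀, u) v` (continuous, compactly supported); §2b two operator-norm trivia for `ℝ`-linear `ℂ`-valued functionals
  (`continuous_smulRight_complex`, `norm_smulRight_complex_le`).
* §3 POINTWISE: for any adelic group datum `𝒢`, Haar `ν` on `U(2,1)`, `ι : U(2,1) →* G(𝔸_K)` and `F` whose orbit function at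
  `x` is locally integrable, the orbital integral `Ψ(x) = ∫ α(u) φ(x ι(u)) dν(u)` (`φ = invQuot F`) is differentiable along the
  probe `b ↦ Ψ(x ι(exp X_b))` at every `b₀`, with derivative `∫ φ(x ι(u)) • D(b₀, u) dν(u)`
  (`hasFDerivAt_orbitalIntegral_expP`; evaluated form `fderiv_orbitalIntegral_expP_apply`: in direction `v` it is the orbital
  integral of the SAME `F` against the derivative kernel `u ↦ D(b₀, u) v`).
* §4 IN `L²` (automorphic `μ`, `ι` continuous): `R(ι g)(∫ α(u) R(ι u) v dν) = ∫ α(g⁻¹u) R(ι u) v dν`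
  (`rightRegular_integral_smul_rightRegular`); the `𝔭`-orbit map `b ↦ R(ι(exp X_b)) w` of a SMOOTHED class
  `w = ∫ α(u) R(ι u) v dν(u)` is differentiable at `0` (`hasFDerivAt_rightRegular_expP_integral_smul`, dominated differentiation
  under the `L²`-valued Bochner integral) and its derivative in direction `b` is the smoothed class
  `∫ (D(0,u) b) • R(ι u) v dν(u)` (`fderiv_rightRegular_expP_integral_smul_apply`) — whose pointwise representative is the orbital
  integral of §3 by `AdelicGroupData.coeFn_integral_smul_rightRegular_toLp_eq_orbitalIntegral`.

USE (cell hodgecm-mathlib, floor 0, P2 (D)-desk, registered stub (R) `StubRRegularOfReproduced` of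
`Lines/F0_P2SpectralProjectionD.lean`): §3 gives `Realises.diff`/`contDeriv`-type data of the representative, §4 the `L²`
derivative it must represent (`Realises.derivAe`), for each entry `α = A · j i` of a regular matrix kernel.

## References
* [Borel1997] A. Borel, *Automorphic forms on SL₂(ℝ)*, Cambridge Tracts 130 (1997), Thm. 2.13–2.14 and §8.4 (regularity
  by convolution: `f ∗ α` is smooth and its derivatives are `f ∗ (Xα)`), §5.14.
* [HarishChandraTAMS1953] Harish-Chandra, Trans. AMS 75 (1953), §9 (differentiation of `∫ f(x) π(x) ψ dx`).
* [BorelJacquetCorvallis1979] A. Borel, H. Jacquet, PSPM 33.1 (1979), §4.6.  [Folland1995] G. B. Folland (1995), §3.2.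
-/

open scoped Topology ContDiff Pointwise
open Set Function Filter
open _root_.MeasureTheory _root_.MeasureTheory.Measure
open Literature.Geometry.ComplexHyperbolic Literature.Geometry.ComplexHyperbolic.BallModel
open Literature.AlgebraicGeometry.ShimuraVarieties Literature.AlgebraicGeometry.ShimuraVarieties.BallForms

noncomputable section

namespace Literature.NumberTheory.Automorphic

namespace OrbitalSmoothingU21

/-! ### 1. The chart `b ↦ exp X_b` -/

/-- `exp X_{-b} = (exp X_b)⁻¹` in `U(2,1)` (the one-parameter group law along the real line through `b`).
[cite: Borel1997, §5.14] -/
theorem expP_neg (b : Fin 2 → ℂ) : expP (-b) = (expP b)⁻¹ := by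
  have h := expP_add_smul 1 (-1) b
  rw [add_neg_cancel, zero_smul, expP_zero, one_smul, neg_one_smul] at h
  exact eq_inv_of_mul_eq_one_right h.symm

section ExpContinuous

open scoped Matrix Matrix.Norms.Operator

/-- `b ↦ exp X_b : ℂ² → U(2,1)` is continuous (matrix exponential; `U(2,1) ≤ GL₃(ℂ)` carries the units topology,
so continuity of `b ↦ (exp X_b)⁻¹ = exp X_{-b}` is also needed). [cite: Borel1997, §5.14] -/
theorem continuous_expP : Continuous expP := by
  have h1 : Continuous fun b : Fin 2 → ℂ ↦ NormedSpace.exp (pMat b) :=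
    NormedSpace.exp_continuous.comp pMatL.continuous
  have h2 : Continuous fun b : Fin 2 → ℂ ↦ NormedSpace.exp (-pMat b) :=
    NormedSpace.exp_continuous.comp pMatL.continuous.neg
  refine continuous_induced_rng.2 (Units.continuous_iff.2 ⟨h1, ?_⟩)
  have : (fun b : Fin 2 → ℂ ↦ (↑((expP b : GL3)⁻¹) : Matrix (Fin 3) (Fin 3) ℂ)) =
      fun b ↦ NormedSpace.exp (-pMat b) := by
    funext b
    have h : ((expP b : GL3)⁻¹ : GL3) = ((expP (-b) : U21) : GL3) := by rw [expP_neg, Subgroup.coe_inv]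
    rw [h]
    show mat (expP (-b)) = _
    have hneg : pMat (-b) = -pMat b := by simpa using pMat_smul (-1) b  -- (= ★ `KonnoKonno2007.pMat_neg`)
    rw [mat_expP, hneg]
  exact h2.congr fun b ↦ (congrFun this b).symm

end ExpContinuous

/-! ### 2. Probe calculus of a scalar kernel that is `C¹` along the left `𝔭`-probes -/

variable {α : U21 → ℂ}

/-- The right-hand probe `b ↦ α((exp X_b)⁻¹ u)` is the left-hand probe `b ↦ α(exp X_b · u)` precomposed with `b ↦ -b`.
[cite: Borel1997, §5.14] -/
theorem comp_expP_inv_mul_eq (u : U21) :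
    (fun b : Fin 2 → ℂ ↦ α ((expP b)⁻¹ * u)) = (fun b : Fin 2 → ℂ ↦ α (expP b * u)) ∘ fun b ↦ -b := by
  funext b
  simp only [comp_apply, expP_neg]

/-- **Differentiability of the right-hand probe**: if `b ↦ α(exp X_b · u)` is `C¹` then `b ↦ α((exp X_b)⁻¹ u)` has the
Fréchet derivative `-(D_b α(exp X_b · u))|_{-b}` at `b`. [cite: Borel1997, §2.13 and §5.14] -/
theorem hasFDerivAt_comp_expP_inv_mul (hdiff : ∀ u : U21, ContDiff ℝ 1 fun b : Fin 2 → ℂ ↦ α (expP b * u))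
    (b : Fin 2 → ℂ) (u : U21) :
    HasFDerivAt (fun b' : Fin 2 → ℂ ↦ α ((expP b')⁻¹ * u))
      (-(fderiv ℝ (fun b' : Fin 2 → ℂ ↦ α (expP b' * u)) (-b))) b := by
  have hg : HasFDerivAt (fun b' : Fin 2 → ℂ ↦ α (expP b' * u))
      (fderiv ℝ (fun b' : Fin 2 → ℂ ↦ α (expP b' * u)) (-b)) (-b) :=
    (((hdiff u).differentiable one_ne_zero) (-b)).hasFDerivAt
  have hneg : HasFDerivAt (fun b' : Fin 2 → ℂ ↦ -b') (-(ContinuousLinearMap.id ℝ (Fin 2 → ℂ))) b :=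
    (hasFDerivAt_id b).neg
  have h := hg.comp b hneg
  rw [comp_expP_inv_mul_eq]
  refine h.congr_fderiv ?_
  rw [ContinuousLinearMap.comp_neg, ContinuousLinearMap.comp_id]

/-- The derivative token: `fderiv ℝ (b' ↦ α((exp X_{b'})⁻¹ u)) b = -(fderiv ℝ (b' ↦ α(exp X_{b'} u)) (-b))`. [cite: Borel1997, §2.13] -/
theorem fderiv_comp_expP_inv_mul (hdiff : ∀ u : U21, ContDiff ℝ 1 fun b : Fin 2 → ℂ ↦ α (expP b * u))
    (b : Fin 2 → ℂ) (u : U21) :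
    fderiv ℝ (fun b' : Fin 2 → ℂ ↦ α ((expP b')⁻¹ * u)) b = -(fderiv ℝ (fun b' : Fin 2 → ℂ ↦ α (expP b' * u)) (-b)) :=
  (hasFDerivAt_comp_expP_inv_mul hdiff b u).fderiv

/-- The right-hand probe is differentiable, with derivative its own `fderiv` (the form consumed by
`hasFDerivAt_orbitalIntegral_mul_hom`). [cite: Borel1997, §2.13] -/
theorem hasFDerivAt_comp_expP_inv_mul' (hdiff : ∀ u : U21, ContDiff ℝ 1 fun b : Fin 2 → ℂ ↦ α (expP b * u))
    (b : Fin 2 → ℂ) (u : U21) :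
    HasFDerivAt (fun b' : Fin 2 → ℂ ↦ α ((expP b')⁻¹ * u))
      (fderiv ℝ (fun b' : Fin 2 → ℂ ↦ α ((expP b')⁻¹ * u)) b) b := by
  rw [fderiv_comp_expP_inv_mul hdiff]
  exact hasFDerivAt_comp_expP_inv_mul hdiff b u

/-- **Joint continuity of the right-hand probe derivative** `(b, u) ↦ fderiv ℝ (b' ↦ α((exp X_{b'})⁻¹ u)) b`, from that of
the left-hand one. [cite: Borel1997, §2.13] -/
theorem continuous_fderiv_comp_expP_inv_mul (hdiff : ∀ u : U21, ContDiff ℝ 1 fun b : Fin 2 → ℂ ↦ α (expP b * u))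
    (hcontD : Continuous fun p : (Fin 2 → ℂ) × U21 ↦ fderiv ℝ (fun b : Fin 2 → ℂ ↦ α (expP b * p.2)) p.1) :
    Continuous fun p : (Fin 2 → ℂ) × U21 ↦ fderiv ℝ (fun b' : Fin 2 → ℂ ↦ α ((expP b')⁻¹ * p.2)) p.1 := by
  have h : Continuous fun p : (Fin 2 → ℂ) × U21 ↦ -(fderiv ℝ (fun b : Fin 2 → ℂ ↦ α (expP b * p.2)) (-p.1)) :=
    (hcontD.comp (continuous_fst.neg.prodMk continuous_snd)).neg
  refine h.congr fun p ↦ ?_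
  rw [fderiv_comp_expP_inv_mul hdiff]

/-- **The probe derivative is compactly supported in `u`** (locally uniformly in `b`): for `u` outside the compact set
`exp(closedBall(b, 1)) · tsupport α` the probe `b' ↦ α((exp X_{b'})⁻¹ u)` vanishes near `b`, so its derivative at `b` is `0`.
[cite: Borel1997, §2.13] -/
theorem fderiv_comp_expP_inv_mul_eq_zero (b : Fin 2 → ℂ) {u : U21}
    (hu : u ∉ expP '' Metric.closedBall b 1 * tsupport α) :
    fderiv ℝ (fun b' : Fin 2 → ℂ ↦ α ((expP b')⁻¹ * u)) b = 0 := by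
  have hloc : (fun b' : Fin 2 → ℂ ↦ α ((expP b')⁻¹ * u)) =ᶠ[𝓝 b] fun _ ↦ (0 : ℂ) := by
    filter_upwards [Metric.isOpen_ball.mem_nhds (Metric.mem_ball_self zero_lt_one)] with b' hb'
    by_contra hne
    exact hu ⟨expP b', mem_image_of_mem _ (Metric.ball_subset_closedBall hb'), (expP b')⁻¹ * u,
      subset_tsupport _ (mem_support.2 hne), mul_inv_cancel_left _ _⟩
  rw [hloc.fderiv_eq, fderiv_const_apply]

/-- The support bound as a `HasCompactSupport` statement (`expP` continuous, closed balls of `ℂ²` compact).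
[cite: Borel1997, §2.13] -/
theorem hasCompactSupport_fderiv_comp_expP_inv_mul (hsupp : HasCompactSupport α) (b : Fin 2 → ℂ) :
    HasCompactSupport fun u : U21 ↦ fderiv ℝ (fun b' : Fin 2 → ℂ ↦ α ((expP b')⁻¹ * u)) b := by
  refine HasCompactSupport.of_support_subset_isCompact
    (((isCompact_closedBall b 1).image continuous_expP).mul hsupp) fun u hu ↦ ?_
  by_contra hnot
  exact hu (fderiv_comp_expP_inv_mul_eq_zero b hnot)

/-- For each direction `v`, the evaluated probe derivative `u ↦ D_b|_{b₀} α((exp X_b)⁻¹ u) · v` is a continuous compactly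
supported scalar weight on `U(2,1)` (the derivative KERNEL in direction `v`). [cite: Borel1997, §2.13] -/
theorem continuous_fderiv_comp_expP_inv_mul_apply
    (hdiff : ∀ u : U21, ContDiff ℝ 1 fun b : Fin 2 → ℂ ↦ α (expP b * u))
    (hcontD : Continuous fun p : (Fin 2 → ℂ) × U21 ↦ fderiv ℝ (fun b : Fin 2 → ℂ ↦ α (expP b * p.2)) p.1)
    (b₀ v : Fin 2 → ℂ) :
    Continuous fun u : U21 ↦ fderiv ℝ (fun b' : Fin 2 → ℂ ↦ α ((expP b')⁻¹ * u)) b₀ v :=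
  ((ContinuousLinearMap.apply ℝ ℂ v).continuous.comp
    ((continuous_fderiv_comp_expP_inv_mul hdiff hcontD).comp (Continuous.prodMk_right b₀)))

/-- Compact support of the derivative kernel in direction `v`. [cite: Borel1997, §2.13] -/
theorem hasCompactSupport_fderiv_comp_expP_inv_mul_apply (hsupp : HasCompactSupport α) (b₀ v : Fin 2 → ℂ) :
    HasCompactSupport fun u : U21 ↦ fderiv ℝ (fun b' : Fin 2 → ℂ ↦ α ((expP b')⁻¹ * u)) b₀ v :=
  (hasCompactSupport_fderiv_comp_expP_inv_mul hsupp b₀).mono fun u hu ↦ by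
    intro h0
    refine hu ?_
    show fderiv ℝ (fun b' : Fin 2 → ℂ ↦ α ((expP b')⁻¹ * u)) b₀ v = 0
    rw [show fderiv ℝ (fun b' : Fin 2 → ℂ ↦ α ((expP b')⁻¹ * u)) b₀ = 0 from h0, _root_.zero_apply]


/-! ### 2b. Continuity of `x ↦ (c x).smulRight (f x)` for an `ℝ`-linear, `ℂ`-valued functional `c x` -/

/-- A complex scalar acting on a complex normed space splits into its real and imaginary parts:
`z • f = (re z) • f + (im z) • (I • f)`. [cite: Folland1995, §3.2] -/
theorem complex_smul_eq_re_smul_add_im_smul {F : Type*} [NormedAddCommGroup F] [NormedSpace ℂ F] (z : ℂ) (f : F) :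
    z • f = z.re • f + z.im • (Complex.I • f) := by
  rw [← Complex.coe_smul, ← Complex.coe_smul, ← mul_smul, ← add_smul, Complex.re_add_im]

/-- **Continuity of `x ↦ (c x).smulRight (f x)`** for `c x : E →L[ℝ] ℂ` and `f x` in a complex normed space, both continuous
in `x` (split `c` into real and imaginary parts, each a `StrongDual ℝ E`, and use Mathlib's continuous trilinear `smulRightL`).
[cite: Folland1995, §3.2] -/
theorem continuous_smulRight_complex {X : Type*} [TopologicalSpace X] {E F : Type*} [NormedAddCommGroup E]
    [NormedSpace ℝ E] [NormedAddCommGroup F] [NormedSpace ℂ F] {c : X → (E →L[ℝ] ℂ)} {f : X → F}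
    (hc : Continuous c) (hf : Continuous f) :
    Continuous fun x ↦ (c x).smulRight (f x) := by
  have hre : Continuous fun x ↦ Complex.reCLM.comp (c x) :=
    (ContinuousLinearMap.compL ℝ E ℂ ℝ Complex.reCLM).continuous.comp hc
  have him : Continuous fun x ↦ Complex.imCLM.comp (c x) :=
    (ContinuousLinearMap.compL ℝ E ℂ ℝ Complex.imCLM).continuous.comp hc
  have hbil : Continuous fun p : (E →L[ℝ] ℝ) × F ↦ p.1.smulRight p.2 :=
    (isBoundedBilinearMap_smulRight (𝕜 := ℝ) (E := E) (F := F)).continuous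
  have h1 : Continuous fun x ↦ (Complex.reCLM.comp (c x)).smulRight (f x) := hbil.comp (hre.prodMk hf)
  have h2 : Continuous fun x ↦ (Complex.imCLM.comp (c x)).smulRight (Complex.I • f x) :=
    hbil.comp (him.prodMk (hf.const_smul Complex.I))
  refine (h1.add h2).congr fun x ↦ ?_
  ext e
  show (Complex.reCLM.comp (c x)).smulRight (f x) e + (Complex.imCLM.comp (c x)).smulRight (Complex.I • f x) e =
    (c x).smulRight (f x) e
  rw [ContinuousLinearMap.smulRight_apply, ContinuousLinearMap.smulRight_apply,
    ContinuousLinearMap.smulRight_apply, ContinuousLinearMap.comp_apply, ContinuousLinearMap.comp_apply,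
    Complex.reCLM_apply, Complex.imCLM_apply]
  exact (complex_smul_eq_re_smul_add_im_smul (c x e) (f x)).symm

/-- `‖c.smulRight f‖ ≤ ‖c‖ ‖f‖` for an `ℝ`-linear `ℂ`-valued functional `c` (operator norm bound). [cite: Folland1995, §3.2] -/
theorem norm_smulRight_complex_le {E F : Type*} [NormedAddCommGroup E] [NormedSpace ℝ E] [NormedAddCommGroup F]
    [NormedSpace ℂ F] (c : E →L[ℝ] ℂ) (f : F) : ‖c.smulRight f‖ ≤ ‖c‖ * ‖f‖ := by
  refine ContinuousLinearMap.opNorm_le_bound _ (by positivity) fun e ↦ ?_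
  rw [ContinuousLinearMap.smulRight_apply, norm_smul]
  calc ‖c e‖ * ‖f‖ ≤ ‖c‖ * ‖e‖ * ‖f‖ := mul_le_mul_of_nonneg_right (c.le_opNorm e) (norm_nonneg _)
    _ = ‖c‖ * ‖f‖ * ‖e‖ := mul_right_comm _ _ _

end OrbitalSmoothingU21

/-! ### 3. The orbital integral along `U(2,1)`-orbits: pointwise probe derivatives -/

namespace AdelicGroupData

open OrbitalSmoothingU21

section Pointwise

variable {K : Type} [Field K] [NumberField K] (𝒢 : AdelicGroupData K) (ν : Measure U21) [ν.IsHaarMeasure]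
  {ι : U21 →* 𝒢.Adelic} {α : U21 → ℂ}

/-- **The orbital integral with a probe-`C¹` kernel is differentiable along every `expP`-probe at every good base point**,
with derivative the orbital integral of the SAME class against the probe derivative of the kernel: for `α` continuous,
compactly supported, `C¹` along the left `𝔭`-probes with jointly continuous probe derivative, and `F` with locally integrable
orbit function at `x`, `D_b|_{b₀} Ψ(x ι(exp X_b)) = ∫ φ(x ι(u)) • D_b|_{b₀} α((exp X_b)⁻¹ u) dν(u)` (`φ = invQuot F`).
[cite: HarishChandraTAMS1953, §9] [cite: Borel1997, Thm. 2.13] -/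
theorem hasFDerivAt_orbitalIntegral_expP (hαc : Continuous α) (hsupp : HasCompactSupport α)
    (hdiff : ∀ u : U21, ContDiff ℝ 1 fun b : Fin 2 → ℂ ↦ α (expP b * u))
    (hcontD : Continuous fun p : (Fin 2 → ℂ) × U21 ↦ fderiv ℝ (fun b : Fin 2 → ℂ ↦ α (expP b * p.2)) p.1)
    (F : 𝒢.automorphicQuotient → ℂ) {x : 𝒢.Adelic} (hx : LocallyIntegrable (fun u ↦ invQuot 𝒢 F (x * ι u)) ν)
    (b₀ : Fin 2 → ℂ) :
    HasFDerivAt (fun b : Fin 2 → ℂ ↦ ∫ u, α u * invQuot 𝒢 F (x * ι (expP b) * ι u) ∂ν)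
      (∫ u, invQuot 𝒢 F (x * ι u) • fderiv ℝ (fun b' : Fin 2 → ℂ ↦ α ((expP b')⁻¹ * u)) b₀ ∂ν) b₀ :=
  𝒢.hasFDerivAt_orbitalIntegral_mul_hom ν hαc hsupp continuous_expP isOpen_univ (mem_univ b₀)
    (D := fun p : (Fin 2 → ℂ) × U21 ↦ fderiv ℝ (fun b' : Fin 2 → ℂ ↦ α ((expP b')⁻¹ * p.2)) p.1)
    (continuous_fderiv_comp_expP_inv_mul hdiff hcontD) (fun b _ u ↦ hasFDerivAt_comp_expP_inv_mul' hdiff b u) F hx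

/-- **The probe derivative of the orbital integral, evaluated**: in the direction `v`,
`D_b|_{b₀} Ψ(x ι(exp X_b)) · v = ∫ (D_b|_{b₀} α((exp X_b)⁻¹ u) · v) φ(x ι(u)) dν(u)` — the orbital integral of the same `F`
against the scalar derivative kernel `u ↦ D(b₀, u) v`. [cite: HarishChandraTAMS1953, §9] [cite: Borel1997, Thm. 2.13] -/
theorem fderiv_orbitalIntegral_expP_apply (hαc : Continuous α) (hsupp : HasCompactSupport α)
    (hdiff : ∀ u : U21, ContDiff ℝ 1 fun b : Fin 2 → ℂ ↦ α (expP b * u))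
    (hcontD : Continuous fun p : (Fin 2 → ℂ) × U21 ↦ fderiv ℝ (fun b : Fin 2 → ℂ ↦ α (expP b * p.2)) p.1)
    (F : 𝒢.automorphicQuotient → ℂ) {x : 𝒢.Adelic} (hx : LocallyIntegrable (fun u ↦ invQuot 𝒢 F (x * ι u)) ν)
    (b₀ v : Fin 2 → ℂ) :
    fderiv ℝ (fun b : Fin 2 → ℂ ↦ ∫ u, α u * invQuot 𝒢 F (x * ι (expP b) * ι u) ∂ν) b₀ v =
      ∫ u, fderiv ℝ (fun b' : Fin 2 → ℂ ↦ α ((expP b')⁻¹ * u)) b₀ v * invQuot 𝒢 F (x * ι u) ∂ν := by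
  rw [(𝒢.hasFDerivAt_orbitalIntegral_expP ν hαc hsupp hdiff hcontD F hx b₀).fderiv]
  have hint : Integrable
      (fun u ↦ invQuot 𝒢 F (x * ι u) • fderiv ℝ (fun b' : Fin 2 → ℂ ↦ α ((expP b')⁻¹ * u)) b₀) ν :=
    hx.integrable_smul_right_of_hasCompactSupport
      ((continuous_fderiv_comp_expP_inv_mul hdiff hcontD).comp (Continuous.prodMk_right b₀))
      (hasCompactSupport_fderiv_comp_expP_inv_mul hsupp b₀)
  rw [ContinuousLinearMap.integral_apply hint v]
  refine congrArg (fun f : U21 → ℂ ↦ ∫ u, f u ∂ν) (funext fun u ↦ ?_)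
  rw [_root_.smul_apply, smul_eq_mul, mul_comm]

/-- The probe of the orbital integral is differentiable at `0` with its derivative token (the `DifferentiableAt` form of
`hasFDerivAt_orbitalIntegral_expP`). [cite: Borel1997, Thm. 2.13] -/
theorem differentiableAt_orbitalIntegral_expP (hαc : Continuous α) (hsupp : HasCompactSupport α)
    (hdiff : ∀ u : U21, ContDiff ℝ 1 fun b : Fin 2 → ℂ ↦ α (expP b * u))
    (hcontD : Continuous fun p : (Fin 2 → ℂ) × U21 ↦ fderiv ℝ (fun b : Fin 2 → ℂ ↦ α (expP b * p.2)) p.1)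
    (F : 𝒢.automorphicQuotient → ℂ) {x : 𝒢.Adelic} (hx : LocallyIntegrable (fun u ↦ invQuot 𝒢 F (x * ι u)) ν)
    (b₀ : Fin 2 → ℂ) :
    DifferentiableAt ℝ (fun b : Fin 2 → ℂ ↦ ∫ u, α u * invQuot 𝒢 F (x * ι (expP b) * ι u) ∂ν) b₀ :=
  (𝒢.hasFDerivAt_orbitalIntegral_expP ν hαc hsupp hdiff hcontD F hx b₀).differentiableAt

end Pointwise

/-! ### 4. The `L²` side: the `𝔭`-orbit map of a smoothed class is differentiable, with derivative a smoothed class -/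

section L2Side

variable {K : Type} [Field K] [NumberField K] (𝒢 : AdelicGroupData K)
  (μ : Measure 𝒢.automorphicQuotient) [𝒢.IsAutomorphicMeasure μ] (ν : Measure U21) [ν.IsHaarMeasure]
  {ι : U21 →* 𝒢.Adelic} {α : U21 → ℂ}

/-- The `L²`-valued integrand `u ↦ α(u) • R(ι u) v` of the smoothing operator is integrable for `α` continuous with compact
support (strong continuity of `R`, `‖R(ι u) v‖ = ‖v‖`). [cite: BorelJacquetCorvallis1979, §4.6] -/
theorem integrable_smul_rightRegular_of_hasCompactSupport (hι : Continuous ι) (hαc : Continuous α)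
    (hsupp : HasCompactSupport α) (v : 𝒢.L2 μ) :
    Integrable (fun u : U21 ↦ α u • 𝒢.rightRegular μ (ι u) v) ν := by
  have hc : Continuous fun u : U21 ↦ 𝒢.rightRegular μ (ι u) v :=
    (𝒢.isStronglyContinuous_rightRegular_holds μ v).comp hι
  exact ((hαc.smul hc).integrable_of_hasCompactSupport (hsupp.smul_right))

/-- **Translating a smoothed class is smoothing with the translated weight**: `R(ι g) (∫ α(u) R(ι u) v dν(u)) =
∫ α(g⁻¹ u) R(ι u) v dν(u)` (`R(ι g)` is continuous linear and multiplicative in `g`; left invariance of `ν`).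
[cite: BorelJacquetCorvallis1979, §4.6] [cite: Folland1995, §3.2] -/
theorem rightRegular_integral_smul_rightRegular (hι : Continuous ι) (hαc : Continuous α)
    (hsupp : HasCompactSupport α) (v : 𝒢.L2 μ) (g : U21) :
    𝒢.rightRegular μ (ι g) (∫ u, α u • 𝒢.rightRegular μ (ι u) v ∂ν) =
      ∫ u, α (g⁻¹ * u) • 𝒢.rightRegular μ (ι u) v ∂ν := by
  rw [← ContinuousLinearMap.integral_comp_comm _
    (𝒢.integrable_smul_rightRegular_of_hasCompactSupport μ ν hι hαc hsupp v)]
  have h := integral_mul_left_eq_self (μ := ν) (fun u ↦ α (g⁻¹ * u) • 𝒢.rightRegular μ (ι u) v) g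
  simp only [inv_mul_cancel_left] at h
  rw [← h]
  refine congrArg (fun f : U21 → 𝒢.L2 μ ↦ ∫ u, f u ∂ν) (funext fun u ↦ ?_)
  rw [ContinuousLinearMap.map_smul, map_mul ι, map_mul (𝒢.rightRegular μ)]
  rfl

/-- **Differentiation under the `L²`-valued integral**: for `α` continuous, compactly supported and `C¹` along the left
`𝔭`-probes with jointly continuous probe derivative, `b ↦ ∫ α((exp X_b)⁻¹ u) • R(ι u) v dν(u)` has, at every `b₀`, the Fréchet
derivative `∫ (D_b|_{b₀} α((exp X_b)⁻¹ u)) ⊗ R(ι u) v dν(u)` (`ContinuousLinearMap.smulRight`; dominated differentiation, the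
integrands living on the compact `exp(B̄(b₀,1))⁻¹… · tsupport α`). [cite: HarishChandraTAMS1953, §9] [cite: Folland1995, §3.2] -/
theorem hasFDerivAt_integral_smul_rightRegular_expP (hι : Continuous ι) (hαc : Continuous α)
    (hsupp : HasCompactSupport α) (hdiff : ∀ u : U21, ContDiff ℝ 1 fun b : Fin 2 → ℂ ↦ α (expP b * u))
    (hcontD : Continuous fun p : (Fin 2 → ℂ) × U21 ↦ fderiv ℝ (fun b : Fin 2 → ℂ ↦ α (expP b * p.2)) p.1)
    (v : 𝒢.L2 μ) (b₀ : Fin 2 → ℂ) :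
    HasFDerivAt (fun b : Fin 2 → ℂ ↦ ∫ u, α ((expP b)⁻¹ * u) • 𝒢.rightRegular μ (ι u) v ∂ν)
      (∫ u, (fderiv ℝ (fun b' : Fin 2 → ℂ ↦ α ((expP b')⁻¹ * u)) b₀).smulRight (𝒢.rightRegular μ (ι u) v) ∂ν) b₀ := by
  -- notation
  set R : U21 → 𝒢.L2 μ := fun u ↦ 𝒢.rightRegular μ (ι u) v with hR
  have hRc : Continuous R := (𝒢.isStronglyContinuous_rightRegular_holds μ v).comp hι
  have hRn : ∀ u, ‖R u‖ = ‖v‖ := fun u ↦ 𝒢.norm_rightRegular_apply μ (ι u) v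
  set D : (Fin 2 → ℂ) × U21 → ((Fin 2 → ℂ) →L[ℝ] ℂ) :=
    fun p ↦ fderiv ℝ (fun b' : Fin 2 → ℂ ↦ α ((expP b')⁻¹ * p.2)) p.1 with hD
  have hDc : Continuous D := continuous_fderiv_comp_expP_inv_mul hdiff hcontD
  -- the compact set carrying all integrands for `b ∈ closedBall b₀ 1`
  set B : Set (Fin 2 → ℂ) := Metric.closedBall b₀ 1 with hB
  have hBc : IsCompact B := isCompact_closedBall _ _
  set C : Set U21 := expP '' B * tsupport α with hC
  have hCc : IsCompact C := (hBc.image continuous_expP).mul hsupp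
  have hzero : ∀ b ∈ B, ∀ u ∉ C, α ((expP b)⁻¹ * u) = 0 := by
    intro b hb u hu
    by_contra hne
    exact hu ⟨expP b, mem_image_of_mem _ hb, (expP b)⁻¹ * u, subset_tsupport _ (mem_support.2 hne),
      mul_inv_cancel_left _ _⟩
  have hDzero : ∀ b ∈ Metric.ball b₀ (1 / 2), ∀ u ∉ C, D (b, u) = 0 := by
    intro b hb u hu
    have hloc : (fun b' : Fin 2 → ℂ ↦ α ((expP b')⁻¹ * u)) =ᶠ[𝓝 b] fun _ ↦ (0 : ℂ) := by
      filter_upwards [Metric.isOpen_ball.mem_nhds hb] with b' hb'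
      refine hzero b' (Metric.ball_subset_closedBall ?_) u hu
      exact lt_of_lt_of_le (Metric.mem_ball.1 hb') (by norm_num)
    show fderiv ℝ (fun b' : Fin 2 → ℂ ↦ α ((expP b')⁻¹ * u)) b = 0
    rw [hloc.fderiv_eq, fderiv_const_apply]
  obtain ⟨M, hM⟩ := (hBc.prod hCc).exists_bound_of_continuousOn (f := D) hDc.continuousOn
  obtain ⟨Mα, hMα⟩ := hαc.bounded_above_of_compact_support hsupp
  have hmeasF : ∀ b, AEStronglyMeasurable (fun u ↦ α ((expP b)⁻¹ * u) • R u) ν := fun b ↦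
    ((hαc.comp (continuous_const.inv.mul continuous_id)).smul hRc).aestronglyMeasurable
  have hCfin : ν C < ⊤ := hCc.measure_lt_top
  have hint₀ : Integrable (fun u ↦ α ((expP b₀)⁻¹ * u) • R u) ν := by
    have hs : HasCompactSupport (fun u ↦ α ((expP b₀)⁻¹ * u) • R u) := by
      refine HasCompactSupport.of_support_subset_isCompact hCc fun u hu ↦ ?_
      by_contra hnot
      exact hu (by simp only [hzero b₀ (Metric.mem_closedBall_self zero_le_one) u hnot, zero_smul])
    exact ((hαc.comp (continuous_const.inv.mul continuous_id)).smul hRc).integrable_of_hasCompactSupport hs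
  have hF'c : Continuous fun u ↦ (D (b₀, u)).smulRight (R u) :=
    continuous_smulRight_complex (hDc.comp (Continuous.prodMk_right b₀)) hRc
  have hhalf : (0 : ℝ) < 1 / 2 := by norm_num
  refine hasFDerivAt_integral_of_dominated_of_fderiv_le (F' := fun b u ↦ (D (b, u)).smulRight (R u))
    (bound := C.indicator fun _ ↦ M * ‖v‖) (s := Metric.ball b₀ (1 / 2))
    (Metric.ball_mem_nhds b₀ hhalf) (Eventually.of_forall hmeasF) hint₀ hF'c.aestronglyMeasurable ?_ ?_ ?_
  · refine Eventually.of_forall fun u b hb ↦ ?_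
    by_cases hu : u ∈ C
    · rw [indicator_of_mem hu]
      have hbB : b ∈ B := Metric.ball_subset_closedBall (lt_of_lt_of_le (Metric.mem_ball.1 hb) (by norm_num))
      calc ‖(D (b, u)).smulRight (R u)‖ ≤ ‖D (b, u)‖ * ‖R u‖ := norm_smulRight_complex_le _ _
        _ ≤ M * ‖v‖ := by
          rw [hRn]
          exact mul_le_mul_of_nonneg_right (hM (b, u) ⟨hbB, hu⟩) (norm_nonneg _)
    · simp [indicator_of_notMem hu, hDzero b hb u hu]
  · rw [integrable_indicator_iff hCc.measurableSet]
    exact integrableOn_const hCfin.ne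
  · exact Eventually.of_forall fun u b _ ↦ (hasFDerivAt_comp_expP_inv_mul' hdiff b u).smul_const (R u)

/-- **The `𝔭`-orbit map of a smoothed class is differentiable at `0`**, with derivative the `CLM`-valued smoothing of the
same class by the probe-derivative kernel: for `w = ∫ α(u) R(ι u) v dν(u)`,
`D_b|_0 R(ι(exp X_b)) w = ∫ (D_b|_0 α((exp X_b)⁻¹ u)) ⊗ R(ι u) v dν(u)`. [cite: HarishChandraTAMS1953, §9] [cite: Borel1997, Thm. 2.13] -/
theorem hasFDerivAt_rightRegular_expP_integral_smul (hι : Continuous ι) (hαc : Continuous α)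
    (hsupp : HasCompactSupport α) (hdiff : ∀ u : U21, ContDiff ℝ 1 fun b : Fin 2 → ℂ ↦ α (expP b * u))
    (hcontD : Continuous fun p : (Fin 2 → ℂ) × U21 ↦ fderiv ℝ (fun b : Fin 2 → ℂ ↦ α (expP b * p.2)) p.1)
    (v : 𝒢.L2 μ) :
    HasFDerivAt (fun b : Fin 2 → ℂ ↦ 𝒢.rightRegular μ (ι (expP b)) (∫ u, α u • 𝒢.rightRegular μ (ι u) v ∂ν))
      (∫ u, (fderiv ℝ (fun b' : Fin 2 → ℂ ↦ α ((expP b')⁻¹ * u)) 0).smulRight (𝒢.rightRegular μ (ι u) v) ∂ν) 0 := by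
  have h := 𝒢.hasFDerivAt_integral_smul_rightRegular_expP μ ν hι hαc hsupp hdiff hcontD v 0
  refine h.congr_of_eventuallyEq (Eventually.of_forall fun b ↦ ?_)
  exact 𝒢.rightRegular_integral_smul_rightRegular μ ν hι hαc hsupp v (expP b)

/-- **The derivative evaluated in a direction is again a smoothed class**:
`(D_b|_0 R(ι(exp X_b)) w) · b = ∫ (D_b|_0 α((exp X_b)⁻¹ u) · b) • R(ι u) v dν(u)` — the smoothing of `v` by the continuous compactly
supported derivative kernel `u ↦ D(0,u) b` (so its pointwise representative is an orbital integral,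
`coeFn_integral_smul_rightRegular_toLp_eq_orbitalIntegral`). [cite: HarishChandraTAMS1953, §9] [cite: Borel1997, Thm. 2.13] -/
theorem fderiv_rightRegular_expP_integral_smul_apply (hι : Continuous ι) (hαc : Continuous α)
    (hsupp : HasCompactSupport α) (hdiff : ∀ u : U21, ContDiff ℝ 1 fun b : Fin 2 → ℂ ↦ α (expP b * u))
    (hcontD : Continuous fun p : (Fin 2 → ℂ) × U21 ↦ fderiv ℝ (fun b : Fin 2 → ℂ ↦ α (expP b * p.2)) p.1)
    (v : 𝒢.L2 μ) (b : Fin 2 → ℂ) :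
    fderiv ℝ (fun b' : Fin 2 → ℂ ↦ 𝒢.rightRegular μ (ι (expP b')) (∫ u, α u • 𝒢.rightRegular μ (ι u) v ∂ν)) 0 b =
      ∫ u, fderiv ℝ (fun b' : Fin 2 → ℂ ↦ α ((expP b')⁻¹ * u)) 0 b • 𝒢.rightRegular μ (ι u) v ∂ν := by
  rw [(𝒢.hasFDerivAt_rightRegular_expP_integral_smul μ ν hι hαc hsupp hdiff hcontD v).fderiv]
  have hRc : Continuous fun u : U21 ↦ 𝒢.rightRegular μ (ι u) v :=
    (𝒢.isStronglyContinuous_rightRegular_holds μ v).comp hι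
  have hint : Integrable (fun u : U21 ↦
      (fderiv ℝ (fun b' : Fin 2 → ℂ ↦ α ((expP b')⁻¹ * u)) 0).smulRight (𝒢.rightRegular μ (ι u) v)) ν := by
    refine Continuous.integrable_of_hasCompactSupport ?_ ?_
    · exact continuous_smulRight_complex
        ((continuous_fderiv_comp_expP_inv_mul hdiff hcontD).comp (Continuous.prodMk_right 0)) hRc
    · refine (hasCompactSupport_fderiv_comp_expP_inv_mul hsupp 0).mono fun u hu ↦ ?_
      intro h0
      refine hu ?_
      show (fderiv ℝ (fun b' : Fin 2 → ℂ ↦ α ((expP b')⁻¹ * u)) 0).smulRight (𝒢.rightRegular μ (ι u) v) = 0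
      rw [show fderiv ℝ (fun b' : Fin 2 → ℂ ↦ α ((expP b')⁻¹ * u)) 0 = 0 from h0]
      ext e
      simp
  rw [ContinuousLinearMap.integral_apply hint b]
  rfl

end L2Side

end AdelicGroupData

end Literature.NumberTheory.Automorphic
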